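import Mathlib
import HarnessLib
import Summits.CriticalPhenomena.PercolationContinuityZ3.Theorems.PercLowPointHalfSpaceLowPointIdentityShift
import Literature.Probability.Percolation.BondPercolationSymmetry

/-!
# Route `PercLowPointHalfSpace`, cross-bush bookkeeping (I): floor mass transport and bush roots

Helper file for item `stmt-CriticalPhenomena-14687` (`CrossBushBookkeeping`:
`BoundaryTwoArmDecay → TallClusterMassBound → QuantitativeBGN → E_{p_c}[N^cross_{n e₀}(U)/|U ∩ ∂ℍ|] → 0`)
of route `CriticalPhenomena/PercLowPointHalfSpace`; first half of step (a) of the item's plan (the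
*second floor mass transport*), valid for EVERY parameter `p` and every dimension `d ≥ 1`, with no
finiteness input:

* `LowPoint.lintegral_floor_transport_le` — **general floor mass-transport inequality**: for any
  non-negative `Φ(ω, c)`, measurable in `ω` and covariant under re-rooting at floor points of the
  half-space cluster `U` (`Φ(ω - c, 0) = Φ(ω, c)` for `c ∈ U(ω) ∩ ∂ℍ`),
  `∫ (Σ_{c ∈ U ∩ ∂ℍ} Φ(ω, c)) / |U ∩ ∂ℍ| dP_p ≤ ∫ Φ(ω, 0) dP_p`
  (Lyons–Peres 2016 §8.2 in its most elementary form: shift invariance of `P_p`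
  (`bondPercolation_map_shift`), invariance of the footprint under re-rooting, Tonelli twice). The floor transport of
  `PercLowPointHalfSpaceAssembly2Glue.lean` (`lintegral_floorPinned_div_footprint_le`) is the case
  `Φ(ω, c) = 𝟙{c + w ∈ U(ω)}`.
* `LowPoint.exists_bushRoot` — every vertex `v ∈ U` with `v₀ ≥ 1` lies in a *bush* (open cluster
  of the raised half-space `ℍ₁ = {1 ≤ x₀}`) having a *root* `c ∈ U ∩ ∂ℍ`: the up-edge
  `{c, c + e₀}` is open and `c + e₀ ↔ v` inside `ℍ₁` (last floor visit of an open path `0 → v`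
  in `ℍ`; configurations opening only lattice edges).

The rooted two-bush bound built from these is in
`PercLowPointHalfSpaceCrossBushBookkeepingRooting.lean`.

This file imports no route (`Theses`) file: everything is about the objects of
`Literature/Probability/Percolation/HalfSpacePinnedPairs.lean`.

Sources: R. Lyons – Y. Peres, *Probability on Trees and Networks* (2016), §8.2 (mass-transport
principle); G. Grimmett, *Percolation* (1999), §7.2 p. 148 (paths "in `A`"). The bush/root device
is the route card's (`lowpoint-identity-halfspace-pinned-pairs`).
-/

noncomputable section

namespace Summit.CriticalPhenomena.PercolationContinuityZ3.Theorems

open MeasureTheory Filter Topology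
open Literature.Probability.Percolation Literature.Probability.LatticeModels
open scoped ENNReal

namespace LowPoint

variable {d : ℕ} [NeZero d]

/-! ## A general floor mass-transport inequality -/

/-- **Floor mass-transport inequality.** Let `Φ(ω, c) ≥ 0` be measurable in `ω` and covariant
under re-rooting at floor points of the half-space cluster: `Φ(ω - c, 0) = Φ(ω, c)` whenever
`c ∈ U(ω)` lies on the floor. Then
`∫ (Σ_{c ∈ U ∩ ∂ℍ} Φ(ω, c)) / |U ∩ ∂ℍ| dP_p ≤ ∫ Φ(ω, 0) dP_p`
for every `p` (with equality when `U` is a.s. finite, not needed here). Proof: Tonelli, the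
substitution `ω ↦ ω - c` in the `c`-th term (`P_p` is shift invariant, the footprint is invariant
under re-rooting), Tonelli again; the re-rooted sum is `Φ(ω,0) · |U ∩ ∂ℍ| / |U ∩ ∂ℍ| ≤ Φ(ω,0)`.
(Lyons–Peres 2016, §8.2, mass transport on the floor lattice.) [cite: LyonsPeres2016, §8.2] -/
theorem lintegral_floor_transport_le (p : unitInterval) (Φ : BondConfig (Site d) → Site d → ℝ≥0∞)
    (hΦ : ∀ c, Measurable fun ω => Φ ω c)
    (hcov : ∀ (ω : BondConfig (Site d)) (c : Site d), c ∈ halfSpaceCluster ω → c 0 = 0 →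
      Φ ((BondConfig.relabel (sym2Equiv (Site.shift (-c))) ω)) 0 = Φ ω c) :
    ∫⁻ ω, (∑' c, (halfSpaceCluster ω ∩ {x | x 0 = 0}).indicator (Φ ω) c) *
        (((halfSpaceFootprint ω : ℕ∞) : ℝ≥0∞))⁻¹ ∂(bondPercolation (zdGraph d) p) ≤
      ∫⁻ ω, Φ ω 0 ∂(bondPercolation (zdGraph d) p) := by
  -- the summands before (`F`) and after (`G`) re-rooting at the floor point `c`
  set F : Site d → BondConfig (Site d) → ℝ≥0∞ := fun c ω =>
    {ω' : BondConfig (Site d) | c ∈ halfSpaceCluster ω' ∧ c 0 = 0}.indicator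
      (fun ω' => Φ ω' c * (((halfSpaceFootprint ω' : ℕ∞) : ℝ≥0∞))⁻¹) ω with hF
  set G : Site d → BondConfig (Site d) → ℝ≥0∞ := fun c ω =>
    {ω' : BondConfig (Site d) | -c ∈ halfSpaceCluster ω' ∧ c 0 = 0}.indicator
      (fun ω' => Φ ω' 0 * (((halfSpaceFootprint ω' : ℕ∞) : ℝ≥0∞))⁻¹) ω with hG
  have hinv : Measurable fun ω : BondConfig (Site d) => (((halfSpaceFootprint ω : ℕ∞) : ℝ≥0∞))⁻¹ :=
    ((Measurable.of_discrete (f := fun n : ℕ∞ => (n : ℝ≥0∞))).comp measurable_halfSpaceFootprint).inv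
  have hFmeas : ∀ c, Measurable (F c) := fun c =>
    Measurable.indicator ((hΦ c).mul hinv)
      ((measurableSet_mem_halfSpaceCluster c).inter (MeasurableSet.const _))
  have hGmeas : ∀ c, Measurable (G c) := fun c =>
    Measurable.indicator ((hΦ 0).mul hinv)
      ((measurableSet_mem_halfSpaceCluster (-c)).inter (MeasurableSet.const _))
  -- step 1: the integrand is `Σ_c F c ω`
  have hstep1 : ∀ ω, (∑' c, (halfSpaceCluster ω ∩ {x | x 0 = 0}).indicator (Φ ω) c) *
      (((halfSpaceFootprint ω : ℕ∞) : ℝ≥0∞))⁻¹ = ∑' c, F c ω := by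
    intro ω
    rw [← ENNReal.tsum_mul_right]
    refine tsum_congr fun c => ?_
    simp only [hF]
    by_cases h : c ∈ halfSpaceCluster ω ∧ c 0 = 0
    · rw [Set.indicator_of_mem (show c ∈ halfSpaceCluster ω ∩ {x | x 0 = 0} from h),
        Set.indicator_of_mem (show ω ∈ {ω' : BondConfig (Site d) | c ∈ halfSpaceCluster ω' ∧
          c 0 = 0} from h)]
    · rw [Set.indicator_of_notMem (show c ∉ halfSpaceCluster ω ∩ {x | x 0 = 0} from h),
        Set.indicator_of_notMem (show ω ∉ {ω' : BondConfig (Site d) | c ∈ halfSpaceCluster ω' ∧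
          c 0 = 0} from h), zero_mul]
  -- step 2: re-rooting, `F c ω = G c (ω - c)`
  have hFG : ∀ c ω, F c ω = G c ((BondConfig.relabel (sym2Equiv (Site.shift (-c))) ω)) := by
    intro c ω
    simp only [hF, hG]
    by_cases hc0 : c 0 = 0
    · by_cases hc : c ∈ halfSpaceCluster ω
      · have himg := halfSpaceCluster_shift_eq_image hc hc0
        have h1 : -c ∈ halfSpaceCluster ((BondConfig.relabel (sym2Equiv (Site.shift (-c))) ω)) := by
          rw [himg]
          exact ⟨0, zero_mem_halfSpaceCluster ω, by simp⟩
        rw [Set.indicator_of_mem (show ω ∈ {ω' : BondConfig (Site d) | c ∈ halfSpaceCluster ω' ∧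
            c 0 = 0} from ⟨hc, hc0⟩),
          Set.indicator_of_mem (show (BondConfig.relabel (sym2Equiv (Site.shift (-c))) ω) ∈ {ω' : BondConfig (Site d) |
            -c ∈ halfSpaceCluster ω' ∧ c 0 = 0} from ⟨h1, hc0⟩),
          halfSpaceFootprint_shift hc hc0, hcov ω c hc hc0]
      · have h1 : -c ∉ halfSpaceCluster ((BondConfig.relabel (sym2Equiv (Site.shift (-c))) ω)) := by
          intro h
          rw [mem_halfSpaceCluster_shift_iff] at h
          simp only [Pi.neg_apply, neg_neg, sub_self, hc0] at h
          exact hc (conn_symm h)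
        rw [Set.indicator_of_notMem (show ω ∉ {ω' : BondConfig (Site d) | c ∈ halfSpaceCluster ω' ∧
            c 0 = 0} from fun h => hc h.1),
          Set.indicator_of_notMem (show (BondConfig.relabel (sym2Equiv (Site.shift (-c))) ω) ∉ {ω' : BondConfig (Site d) |
            -c ∈ halfSpaceCluster ω' ∧ c 0 = 0} from fun h => h1 h.1)]
    · rw [Set.indicator_of_notMem (show ω ∉ {ω' : BondConfig (Site d) | c ∈ halfSpaceCluster ω' ∧
          c 0 = 0} from fun h => hc0 h.2),
        Set.indicator_of_notMem (show (BondConfig.relabel (sym2Equiv (Site.shift (-c))) ω) ∉ {ω' : BondConfig (Site d) |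
          -c ∈ halfSpaceCluster ω' ∧ c 0 = 0} from fun h => hc0 h.2)]
  -- the floor points `c` with `-c ∈ U(ω)` are `-(U(ω) ∩ ∂ℍ)`; their number is the footprint
  have hfoot : ∀ ω : BondConfig (Site d),
      ({c : Site d | -c ∈ halfSpaceCluster ω ∧ c 0 = 0}).encard = halfSpaceFootprint ω := by
    intro ω
    rw [halfSpaceFootprint_def]
    have hset : {c : Site d | -c ∈ halfSpaceCluster ω ∧ c 0 = 0} =
        (fun u => -u) '' (halfSpaceCluster ω ∩ {x | x 0 = 0}) := by
      ext c
      simp only [Set.mem_setOf_eq, Set.mem_image, Set.mem_inter_iff]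
      constructor
      · rintro ⟨h1, h2⟩
        exact ⟨-c, ⟨h1, by simp [h2]⟩, neg_neg c⟩
      · rintro ⟨u, ⟨h1, h2⟩, rfl⟩
        exact ⟨by simpa using h1, by simp [h2]⟩
    rw [hset, neg_injective.encard_image]
  -- step 3: the re-rooted sum is `Φ(ω,0) · |U ∩ ∂ℍ| / |U ∩ ∂ℍ| ≤ Φ(ω,0)`
  have hstep3 : ∀ ω, ∑' c, G c ω ≤ Φ ω 0 := by
    intro ω
    simp only [hG]
    have hterm : ∀ c, {ω' : BondConfig (Site d) | -c ∈ halfSpaceCluster ω' ∧ c 0 = 0}.indicator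
        (fun ω' => Φ ω' 0 * (((halfSpaceFootprint ω' : ℕ∞) : ℝ≥0∞))⁻¹) ω =
        {c : Site d | -c ∈ halfSpaceCluster ω ∧ c 0 = 0}.indicator
          (fun _ => Φ ω 0 * (((halfSpaceFootprint ω : ℕ∞) : ℝ≥0∞))⁻¹) c := by
      intro c
      by_cases h : -c ∈ halfSpaceCluster ω ∧ c 0 = 0
      · rw [Set.indicator_of_mem (show c ∈ {c : Site d | -c ∈ halfSpaceCluster ω ∧ c 0 = 0} from h),
          Set.indicator_of_mem (show ω ∈ {ω' : BondConfig (Site d) | -c ∈ halfSpaceCluster ω' ∧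
            c 0 = 0} from h)]
      · rw [Set.indicator_of_notMem (show c ∉ {c : Site d | -c ∈ halfSpaceCluster ω ∧ c 0 = 0}
            from h),
          Set.indicator_of_notMem (show ω ∉ {ω' : BondConfig (Site d) | -c ∈ halfSpaceCluster ω' ∧
            c 0 = 0} from h)]
    rw [tsum_congr hterm, ← tsum_subtype, ENNReal.tsum_set_const, hfoot ω]
    calc ((halfSpaceFootprint ω : ℕ∞) : ℝ≥0∞) *
          (Φ ω 0 * (((halfSpaceFootprint ω : ℕ∞) : ℝ≥0∞))⁻¹)
        = Φ ω 0 * (((halfSpaceFootprint ω : ℕ∞) : ℝ≥0∞) *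
            (((halfSpaceFootprint ω : ℕ∞) : ℝ≥0∞))⁻¹) := by ring
      _ ≤ Φ ω 0 * 1 := by gcongr; exact ENNReal.mul_inv_le_one _
      _ = Φ ω 0 := mul_one _
  -- assembling: Tonelli, shift invariance, Tonelli
  calc ∫⁻ ω, (∑' c, (halfSpaceCluster ω ∩ {x | x 0 = 0}).indicator (Φ ω) c) *
        (((halfSpaceFootprint ω : ℕ∞) : ℝ≥0∞))⁻¹ ∂(bondPercolation (zdGraph d) p)
      = ∫⁻ ω, ∑' c, F c ω ∂(bondPercolation (zdGraph d) p) := lintegral_congr hstep1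
    _ = ∑' c, ∫⁻ ω, F c ω ∂(bondPercolation (zdGraph d) p) :=
        lintegral_tsum fun c => (hFmeas c).aemeasurable
    _ = ∑' c, ∫⁻ ω, G c ((BondConfig.relabel (sym2Equiv (Site.shift (-c))) ω)) ∂(bondPercolation (zdGraph d) p) :=
        tsum_congr fun c => lintegral_congr fun ω => hFG c ω
    _ = ∑' c, ∫⁻ ω, G c ω ∂(bondPercolation (zdGraph d) p) := by
        refine tsum_congr fun c => ?_
        rw [← lintegral_map_equiv (G c) (BondConfig.relabel (sym2Equiv (Site.shift (-c)))),
          bondPercolation_map_shift]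
    _ = ∫⁻ ω, ∑' c, G c ω ∂(bondPercolation (zdGraph d) p) :=
        (lintegral_tsum fun c => (hGmeas c).aemeasurable).symm
    _ ≤ ∫⁻ ω, Φ ω 0 ∂(bondPercolation (zdGraph d) p) := lintegral_mono hstep3

/-! ## Bushes and their roots -/

/-- **Every raised vertex of `U` lies in a rooted bush.** For a configuration opening only
lattice edges, if `v ∈ U(ω)` has `v₀ ≥ 1` then there is a floor point `c ∈ U(ω)` (a *root* of
the bush of `v`) whose up-edge `{c, c + e₀}` is open and with `c + e₀ ↔ v` inside
`ℍ₁ = {1 ≤ x₀}`: follow an open path from `v` to `0` inside `ℍ` up to its first floor vertex.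
[folklore] -/
theorem exists_bushRoot {ω : BondConfig (Site d)} (hω : ω ⊆ (zdGraph d).edgeSet) {v : Site d}
    (hv : v ∈ halfSpaceCluster ω) (hv1 : 1 ≤ v 0) :
    ∃ c : Site d, c ∈ halfSpaceCluster ω ∧ c 0 = 0 ∧ s(c, c + Pi.single 0 1) ∈ ω ∧
      ω ∈ openConnIn {x : Site d | 1 ≤ x 0} (c + Pi.single 0 1) v := by
  -- the open-step graphs inside `ℍ` and inside `ℍ₁`
  set K : SimpleGraph (Site d) := openGraph ω ⊓ withinGraph ⊤ (halfSpace d) with hK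
  set K₁ : SimpleGraph (Site d) := openGraph ω ⊓ withinGraph ⊤ {x : Site d | 1 ≤ x 0} with hK₁
  have h0H : (0 : Site d) ∈ halfSpace d := zero_mem_halfSpace d
  -- claim, by induction along an open walk `a → 0` inside `ℍ` starting at level `≥ 1`
  have key : ∀ (a b : Site d) (q : K.Walk a b), b = 0 → 1 ≤ a 0 →
      ∃ c : Site d, K.Reachable c 0 ∧ c 0 = 0 ∧ s(c, c + Pi.single 0 1) ∈ ω ∧
        K₁.Reachable (c + Pi.single 0 1) a := by
    intro a b q
    induction q with
    | nil =>
      intro hb h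
      subst hb
      simp at h
    | @cons a b x hab q ih =>
      intro hx ha
      subst hx
      have hab' : (openGraph ω).Adj a b := hab.1
      rw [openGraph_adj] at hab'
      have hbH : b ∈ halfSpace d := hab.2.2.2
      have hb0 : 0 ≤ b 0 := hbH
      by_cases hb1 : 1 ≤ b 0
      · obtain ⟨c, hc0, hc, hce, hcb⟩ := ih rfl hb1
        refine ⟨c, hc0, hc, hce, hcb.trans (SimpleGraph.Adj.reachable ?_)⟩
        rw [hK₁, SimpleGraph.inf_adj, openGraph_adj, withinGraph_adj, SimpleGraph.top_adj]
        exact ⟨⟨Sym2.eq_swap ▸ hab'.1, hab'.2.symm⟩, hab'.2.symm, hb1, ha⟩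
      · -- `b` is the first floor vertex: `b₀ = 0`, and then `a = b + e₀`
        have hb00 : b 0 = 0 := by omega
        have hadj : (zdGraph d).Adj a b := (SimpleGraph.mem_edgeSet (zdGraph d)).1 (hω hab'.1)
        have hab_eq : a = b + Pi.single 0 1 := by
          obtain ⟨i, h | h⟩ := (zdGraph_adj_iff a b).1 hadj
          · have h' := congrFun h 0
            simp only [Pi.add_apply, Pi.single_apply] at h'
            split_ifs at h' <;> omega
          · by_cases hi : (0 : Fin d) = i
            · subst hi; exact h
            · have h' := congrFun h 0
              rw [Pi.add_apply, Pi.single_apply, if_neg hi] at h'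
              omega
        refine ⟨b, ⟨q⟩, hb00, ?_, ?_⟩
        · rw [← hab_eq, Sym2.eq_swap]; exact hab'.1
        · rw [← hab_eq]
  -- apply the claim to an open walk `v → 0` inside `ℍ`
  have hreach : K.Reachable 0 v := by
    have h := (conn_iff_mem_cluster h0H).1 (mem_halfSpaceCluster_iff.1 hv)
    rwa [mem_openClusterIn_iff] at h
  obtain ⟨q⟩ := hreach.symm
  obtain ⟨c, hc0, hc, hce, hcv⟩ := key v 0 q rfl hv1
  refine ⟨c, ?_, hc, hce, ?_⟩
  · rw [mem_halfSpaceCluster_iff, conn_iff_mem_cluster h0H, mem_openClusterIn_iff]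
    exact hc0.symm
  · have hc1 : c + Pi.single 0 1 ∈ {x : Site d | 1 ≤ x 0} := by
      simp [Pi.add_apply, hc]
    rw [conn_iff_mem_cluster hc1, mem_openClusterIn_iff]
    exact hcv

end LowPoint

end Summit.CriticalPhenomena.PercolationContinuityZ3.Theorems

end
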